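import Summits.QuantumFields.YangMills.Theorems.BalabanUVNodesN18AtRateRecord11
import Summits.QuantumFields.YangMills.Theorems.BalabanUVNodesRateCarriersOfRecord11
import Literature.MathematicalPhysics.QuantumFieldTheory.Balaban1983to89.Node00.HistoryTermsOfRecord

/-!
# BalabanUVNodes ∕ node N18 = NE5 — `S_N18` AT THE RATE-RECORD HOME OF RECORD `YMDAG.UVSplit.RRec₁₁ 𝔯` (layer B, p457330): the ONE
# APPLICATION, in the θ-form a definer proves, for BOTH constructors of record of the reading's U3 objects — the FIXED-CARRIER reading
# `U3Objects₁₁.ofFixed` (an END bundle carrying `N18At`, letters of record dominating; in particular THE H-LAYER END `EnvelopeOnRecord` WITH THE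
# NODE-A MAJORANT AS HYPOTHESIS) and the TOWER reading `U3Tower₁₁.objects` (comap + window agreement) — and what `S_N18 (RRec₁₁ 𝔯)` hands back

Cell `pub-ymgap`, HUMAN RULING D-0062 (Track A), R134 seat `pub-ymgap-dag-n18-d` (strategy s2: by-name knit at the ₁₁ record; row «knit `T4OutputRate.NE5`
from `EnvelopeOnRecord*` faces with the NODE-A majorant as hypothesis at `RRec` ₁₁»), generation 0, module 5.  THEOREMS ONLY (0 `def`, 0 `sorry`, standard
axioms); imports this seat's module 4 (p456073 ✓ 25df1b873133: `n18At_level_ofFixed_iff`, `n18At_level_ofFixed_of_mono`, `n18At_level_ofFixed_of_envelopeOnRecord`,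
`n18At_level_tower_of_comap_agree`; through it modules 3 ∕ 1 and layer A `Node00/RateRecord11` p455395) and LAYER B of the rate-record home
(`BalabanUVNodesRateCarriersOfRecord11`, seat n22-e, p457330 ✓ d94e8890fa3a: `RateReading₁₁`, `u3OfRecord₁₁`, `RRec₁₁`, `s_N18_rRec₁₁_iff`,
`forall_datumKey_of_forall_admissible`) and, for §6 only, definer W1's `Node00/HistoryTermsOfRecord` (p455641 ✓: `W1.histCarriers`, `W1.functionalOn`,
`W1.functionalC`, `W1.ClusterTower` — the (2.13) terms of record AS A DEFINITION); modifies nothing; `--supports stmt-QuantumFields-19676` (K3 `SpineGivenEndpointR11`).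

THE SLOT (layer B, `Iff.rfl`-exact with module 4's literal).  `RRec₁₁ 𝔯 F D g₀ os R :↔ ∃ (h : IsDatumOfRecord₁₁C F N D) k, R = rateCarriersOfRecord₁₁ 𝔯 F h.params g₀ os k`
and `(rateCarriersOfRecord₁₁ 𝔯 F θ g₀ os k).u3 = u3OfRecord₁₁ θ (𝔯.lit F θ g₀ os).u3 k = ⟨u.levelCarriers k, Window θ.γ, θ.γ, u.κ, u.EA k, u.EB k, u.θ₅, u.C₅, u.moduli, u.C₉, u.ω, u.cr, u.ρ⟩`
— module 4's literal with `γ := θ.γ`, so every face below is ONE application of a module-4 theorem behind layer B's `s_N18_rRec₁₁_iff`.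
* §0 `n18At_u3OfRecord₁₁_iff` (`Iff.rfl`): N18 at the bundle of record IS «∀ b ∈ ]0, θ.γ], `NE5 (u.EA k) (u.EB k b) (Window θ.γ) u.κ u.θ₅ u.C₅`».
* §1 THE ONE APPLICATION, θ-FORM: `s_N18_rRec₁₁_of_forall_admissible` ∕ `_of_forall_ne5` — what a definer proves at EVERY admissible Stage-11 tuple with
  provisos (no datum, no world in sight) closes `S_N18 (RRec₁₁ 𝔯)` (layer B's `forall_datumKey_of_forall_admissible` pattern); conversely
  `ne5_of_s_N18_rRec₁₁` — what N17's knit ∕ N19's rate edge ∕ K4 get back at a datum key: NE5 at every level and member.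
* §2 FIXED-CARRIER READING AT THE HOME: `s_N18_rRec₁₁_of_ofFixed` (the reading's U3 objects at each admissible tuple ARE `ofFixed C EA EB ℓ` with
  `N18At ⟨C, Window θ.γ, θ.γ, ℓ.κ, EA, EB, ℓ.θ₅, ℓ.C₅, …⟩`), `s_N18_rRec₁₁_of_ofFixed_mono` (… ARE `ofFixed v.C v.EA v.EB ℓ` for ANY bundle `v` with `N18At v`
  whose window contains `Window θ.γ`, radius `≥ θ.γ`, and whose letters the record's DOMINATE: `ℓ.κ ≤ v.κ`, `0 ≤ v.θ ≤ ℓ.θ₅`, `0 ≤ v.C₅ ≤ ℓ.C₅`).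
* §3 THE ROW — THE H-LAYER END AT THE HOME WITH THE NODE-A MAJORANT AS HYPOTHESIS: `s_N18_rRec₁₁_of_envelopeOnRecord` — if at every admissible tuple the
  reading's U3 objects are `ofFixed Rr.carriers EA EB ℓ` for a two-run datum `Rr` carrying module 1's END binder list VERBATIM (per-member step models with
  (2.13) as output `hrep`, the NODE-A majorant `hH`, leaves L01–L03 ∕ L05–L09unit, located numerals, reach and sharp clauses) on a window `W ⊇ Window θ.γ` of
  radius `γ′ ≥ θ.γ`, with `ℓ.κ ≤ κ`, `θ′ ≤ ℓ.θ₅`, `C₅(C₃ε₁) ≤ ℓ.C₅`, then `S_N18 (RRec₁₁ 𝔯)` — module 4's `n18At_level_ofFixed_of_envelopeOnRecord` once per key.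
* §4 TOWER READING AT THE HOME: `s_N18_rRec₁₁_of_tower` — the reading's U3 objects are `t.objects ℓ` and at every level `k` some bundle `v` with `N18At v`
  is read through maps `t.Dom → v.C.Dom`, `t.B → v.C.BgA ∕ BgB` (scale ∕ tree length ∕ transport compatibilities, agreement of `t.E k` and
  `t.E (k+1) ∘ prependCoupling b` with `v`'s functionals on `Window θ.γ`, letter domination) — module 4's `n18At_level_tower_of_comap_agree` once per level.
* §5 LOCATED VACUITY (honesty): `s_N18_rRec₁₁_of_null` — a reading whose level functionals VANISH identically with `0 ≤ θ₅`, `0 ≤ C₅` satisfies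
  `S_N18 (RRec₁₁ 𝔯)` WITH NO ESTIMATE: the stub at the home certifies nothing by itself; it is NE5's content exactly for the PINNED reading (W1's (2.13)
  functionals of record, `Node00/HistoryTermsOfRecord`), refutable for other junk (`YMDAG.N18.not_s_N18_of_admits`).
* §6 THE READING IN THE DEFINER's CURRENCY: `n18At_u3OfRecord₁₁_histCarriers_iff` (`Iff.rfl`) — N18 at the bundle of record of the fixed-carrier objects on
  W1's `histCarriers` with run A's functional `W1.functionalOn S` and run B's `(b, g, U, X) ↦ Re E_B(πX; b∷g; embB U)` (towers `S ∕ S′` of one-step cluster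
  data, the UNPRINTED pairing data `gauge ∕ tr ∕ π ∕ embA ∕ embB` as PARAMETERS) IS the η-rate inequality
  `|Re E_A^{(j)}(X; g; embA (tr U)) − Re E_B(πX; b∷g; embB U)| ≤ C₅·θ₅^j·e^{−κ d_j(X)}` for Bałaban's (2.13) terms; `s_N18_rRec₁₁_of_histCarriers` — a reading
  PINNED to these objects with that inequality closes `S_N18 (RRec₁₁ 𝔯)` (the pin is nobody's yet; the inequality is N18's estimate, NOT in print).

HONEST FRAMING.  Kernel bookkeeping BY NAME (`Iff.rfl`, `rw`, one application each); restates nothing; no Theses import (restate-immune).  The residual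
reading `𝔯` is a PARAMETER: nobody has pinned `𝔯.lit … .u3` to W1's object yet, the END binders of §3 (NODE-A majorant `hH` = [II] Lemma 3 (2.38) for
Bałaban's (2.14)-term activities; `hrep` = (2.13); the leaves = NODE O ∕ rows NE2–NE3) are instanced by nobody; NE5 is NOT IN PRINT for d = 4
([Balaban1987RG1] Thm 1 p. 259 states the flow, not the η-rate) and NOT proved here; K0 (an inhabitant of `IsDatumOfRecord₁₁C`) open; N18 NOT discharged
(typed 28∕28 · discharged count of record unmoved).  One finite four-torus programme at fixed `ε`; NOT infinite volume, NOT OS on ℝ⁴, NOT a mass gap, NOT Clay.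
-/

noncomputable section

namespace YMDAG.N18.HLayer

open Literature.MathematicalPhysics.QuantumFieldTheory.Balaban1983to89
open Literature.MathematicalPhysics.QuantumFieldTheory.Balaban1983to89.T4Continuum
open Literature.MathematicalPhysics.QuantumFieldTheory.Balaban1983to89.T4OutputRate (Carriers Functional NE5 Window)
open Literature.MathematicalPhysics.QuantumFieldTheory.Balaban1983to89.T4InputCauchyRateData (StepModel)
open Literature.MathematicalPhysics.QuantumFieldTheory.Balaban1983to89.B13Resummation (locE)
open Literature.MathematicalPhysics.QuantumFieldTheory.Balaban1983to89.TreeLengthTorus (TDom tsys torusTreeLen)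
open Literature.MathematicalPhysics.QuantumFieldTheory.Balaban1983to89.TreeLengthTorusGeometry (TTouch)
open Literature.MathematicalPhysics.QuantumFieldTheory.Balaban1983to89.B12TreeDecay (K₀)
open Literature.MathematicalPhysics.QuantumFieldTheory.Balaban1983to89.Node00 (Stage11Params IsDatumOfRecord₁₁C U3Letters₁₁ U3Objects₁₁
  U3Tower₁₁ prependCoupling)
open Summit.QuantumFields.BalabanUV.T4Continuum.B13Carriers (TwoRuns)
open Summit.QuantumFields.BalabanUV.T4Continuum.Spine.NE5
open YMDAG.UVSplit

variable {N : ℕ} [NeZero N]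

/-! ## §0 The reading of N18 at the bundle of record -/

/-- **WHAT N18 SAYS AT THE BUNDLE OF RECORD** `u3OfRecord₁₁ θ u k` (`Iff.rfl`; module 4's `n18At_level_iff` at `γ := θ.γ`): for every member `b ∈ ]0, θ.γ]`
of run B's first-coupling family, the two-run η-rate `NE5 (u.EA k) (u.EB k b) (Window θ.γ) u.κ u.θ₅ u.C₅` on the level-`k` pair carriers — i.e.
`|u.EA k g (transport U) X − u.EB k b g U X| ≤ u.C₅ · u.θ₅ ^ scale X · e^{−u.κ·d X}` for `g ∈ ]0, θ.γ]^ℕ`. [cite: Balaban1987RG1, Thm 1 p.259 and (1.18) p.263] -/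
theorem n18At_u3OfRecord₁₁_iff {F : T4Family} (θ : Stage11Params F N) (u : U3Objects₁₁) (k : ℕ) :
    N18At (u3OfRecord₁₁ θ u k) ↔ ∀ b : ℝ, 0 < b → b ≤ θ.γ → NE5 (u.EA k) (u.EB k b) (Window θ.γ) u.κ u.θ₅ u.C₅ :=
  Iff.rfl

/-! ## §1 The one application, θ-form; and what the stub hands back -/

variable (𝔯 : RateReading₁₁ N)

/-- **THE ONE APPLICATION, θ-FORM** [bookkeeping]: if at EVERY admissible Stage-11 tuple `θ` with provisos, every `(g₀, os)` and every run length `k` the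
reading's bundle of record carries `N18At`, then `S_N18 (RRec₁₁ 𝔯)` — the datum key `h : IsDatumOfRecord₁₁C F N D` reads its objects at the canonical
`h.params`, which is admissible with provisos. [cite: Balaban1987RG1, Thm 1 p.259] -/
theorem s_N18_rRec₁₁_of_forall_admissible
    (h : ∀ (F : T4Family) (θ : Stage11Params F N), θ.Provisos₁₁ → θ.Admissible →
      ∀ (g₀ : ℕ → ℝ) (os : List (ULoop F)) (k : ℕ), N18At (u3OfRecord₁₁ θ (𝔯.lit F θ g₀ os).u3 k)) :
    S_N18 (RRec₁₁ 𝔯) :=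
  (s_N18_rRec₁₁_iff 𝔯).2 fun F _ hk g₀ os k => h F hk.params hk.provisos hk.admissible g₀ os k

/-- **THE ONE APPLICATION, NE5 SPELLED OUT** [bookkeeping]: NE5 for the reading's level functionals `u.EA k`, `u.EB k b` on `]0, θ.γ]^ℕ` at the letter
block's `(κ, θ₅, C₅)`, for every admissible tuple with provisos, every `(g₀, os)`, level `k` and member `b ∈ ]0, θ.γ]`, closes `S_N18 (RRec₁₁ 𝔯)`.
[cite: Balaban1987RG1, Thm 1 p.259 and (1.18) p.263] -/
theorem s_N18_rRec₁₁_of_forall_ne5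
    (h : ∀ (F : T4Family) (θ : Stage11Params F N), θ.Provisos₁₁ → θ.Admissible →
      ∀ (g₀ : ℕ → ℝ) (os : List (ULoop F)) (k : ℕ) (b : ℝ), 0 < b → b ≤ θ.γ →
        NE5 ((𝔯.lit F θ g₀ os).u3.EA k) ((𝔯.lit F θ g₀ os).u3.EB k b) (Window θ.γ) (𝔯.lit F θ g₀ os).u3.κ
          (𝔯.lit F θ g₀ os).u3.θ₅ (𝔯.lit F θ g₀ os).u3.C₅) :
    S_N18 (RRec₁₁ 𝔯) :=
  s_N18_rRec₁₁_of_forall_admissible 𝔯 fun F θ hP hA g₀ os k => (n18At_u3OfRecord₁₁_iff θ _ k).2 (h F θ hP hA g₀ os k)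

/-- **WHAT `S_N18 (RRec₁₁ 𝔯)` HANDS BACK AT A DATUM KEY** [bookkeeping] (N17's knit `N17_of_ne5_readOut`, N19's rate edge, K4 read it so): at every datum
of record, every `(g₀, os)`, level `k` and member `b ∈ ]0, θ.γ]` (θ = the canonical parameter), NE5 for the reading's level functionals on `]0, θ.γ]^ℕ` at
the letter block's `(κ, θ₅, C₅)`. [cite: Balaban1987RG1, Thm 1 p.259 and (1.18) p.263] -/
theorem ne5_of_s_N18_rRec₁₁ (hS : S_N18 (RRec₁₁ 𝔯)) {F : T4Family} {D : Datum F N} (hk : IsDatumOfRecord₁₁C F N D) (g₀ : ℕ → ℝ)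
    (os : List (ULoop F)) (k : ℕ) {b : ℝ} (hb : 0 < b) (hbγ : b ≤ hk.params.γ) :
    NE5 ((𝔯.lit F hk.params g₀ os).u3.EA k) ((𝔯.lit F hk.params g₀ os).u3.EB k b) (Window hk.params.γ)
      (𝔯.lit F hk.params g₀ os).u3.κ (𝔯.lit F hk.params g₀ os).u3.θ₅ (𝔯.lit F hk.params g₀ os).u3.C₅ :=
  (n18At_u3OfRecord₁₁_iff hk.params _ k).1 ((s_N18_rRec₁₁_iff 𝔯).1 hS F D hk g₀ os k) b hb hbγ

/-! ## §2 The fixed-carrier reading at the home -/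

/-- **FIXED CARRIERS AT THE HOME** [bookkeeping]: if at every admissible tuple with provisos and every `(g₀, os)` the reading's U3 objects ARE the fixed
bundle `U3Objects₁₁.ofFixed C EA EB ℓ` of one pair-carrier structure (W1's `histCarriers ∕ functional` shape, the H-layer END's `TwoRuns.carriers`) with
`N18At ⟨C, Window θ.γ, θ.γ, ℓ.κ, EA, EB, ℓ.θ₅, ℓ.C₅, …⟩`, then `S_N18 (RRec₁₁ 𝔯)` (module 4's `n18At_level_ofFixed_iff` at every level).
[cite: Balaban1989LargeFieldII, (2.13)–(2.14) p.359; Balaban1987RG1, Thm 1 p.259] -/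
theorem s_N18_rRec₁₁_of_ofFixed
    (h : ∀ (F : T4Family) (θ : Stage11Params F N), θ.Provisos₁₁ → θ.Admissible → ∀ (g₀ : ℕ → ℝ) (os : List (ULoop F)),
      ∃ (C : Carriers) (EA : Functional C C.BgA) (EB : ℝ → Functional C C.BgB) (ℓ : U3Letters₁₁),
        (𝔯.lit F θ g₀ os).u3 = U3Objects₁₁.ofFixed C EA EB ℓ ∧
        N18At ⟨C, Window θ.γ, θ.γ, ℓ.κ, EA, EB, ℓ.θ₅, ℓ.C₅, ℓ.moduli, ℓ.C₉, ℓ.ω, ℓ.cr, ℓ.ρ⟩) :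
    S_N18 (RRec₁₁ 𝔯) := by
  refine s_N18_rRec₁₁_of_forall_admissible 𝔯 fun F θ hP hA g₀ os k => ?_
  obtain ⟨C, EA, EB, ℓ, hu, hN⟩ := h F θ hP hA g₀ os
  rw [hu]
  exact (n18At_level_ofFixed_iff C EA EB ℓ θ.γ k).2 hN

/-- **FIXED CARRIERS AT THE HOME, THE RECORD's LETTERS DOMINATING AN END's** [bookkeeping]: if at every admissible tuple with provisos and every `(g₀, os)`
the reading's U3 objects ARE `U3Objects₁₁.ofFixed v.C v.EA v.EB ℓ` for SOME U3 bundle `v` carrying `N18At v` (the H-layer END's bundle of module 1 ∕ 2,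
n18-a's primitive-rate bundle, …) whose window contains `]0, θ.γ]^ℕ` with radius `≥ θ.γ` and whose letters the record's dominate (`ℓ.κ ≤ v.κ`,
`0 ≤ v.θ ≤ ℓ.θ₅`, `0 ≤ v.C₅ ≤ ℓ.C₅`), then `S_N18 (RRec₁₁ 𝔯)` (module 4's `n18At_level_ofFixed_of_mono` at every level).
[cite: Balaban1987RG1, Thm 1 p.259 and (1.18) p.263] -/
theorem s_N18_rRec₁₁_of_ofFixed_mono
    (h : ∀ (F : T4Family) (θ : Stage11Params F N), θ.Provisos₁₁ → θ.Admissible → ∀ (g₀ : ℕ → ℝ) (os : List (ULoop F)),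
      ∃ (v : U3Carriers) (ℓ : U3Letters₁₁),
        (𝔯.lit F θ g₀ os).u3 = U3Objects₁₁.ofFixed v.C v.EA v.EB ℓ ∧ N18At v ∧
        Window θ.γ ⊆ v.W ∧ θ.γ ≤ v.γ ∧ ℓ.κ ≤ v.κ ∧ 0 ≤ v.θ ∧ v.θ ≤ ℓ.θ₅ ∧ 0 ≤ v.C₅ ∧ v.C₅ ≤ ℓ.C₅) :
    S_N18 (RRec₁₁ 𝔯) := by
  refine s_N18_rRec₁₁_of_forall_admissible 𝔯 fun F θ hP hA g₀ os k => ?_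
  obtain ⟨v, ℓ, hu, hv, hW, hγ, hκ, hθ, hθ', hC₅, hC⟩ := h F θ hP hA g₀ os
  rw [hu]
  obtain ⟨C, W, γv, κv, EAv, EBv, θv, C₅v, Λv, C₉v, ωv, crv, ρv⟩ := v
  exact n18At_level_ofFixed_of_mono ℓ k hv hW hγ hκ hθ hθ' hC₅ hC

/-! ## §3 The row: the H-layer END at the home, the NODE-A majorant as hypothesis -/

open Classical in
/-- **THE H-LAYER END AT THE RATE-RECORD HOME, WITH THE NODE-A MAJORANT AS HYPOTHESIS** [bookkeeping] — the row «knit `T4OutputRate.NE5` from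
`EnvelopeOnRecord*` faces at `RRec` ₁₁»: if at EVERY admissible Stage-11 tuple `θ` with provisos and every `(g₀, os)` the reading's U3 objects ARE the fixed
bundle `U3Objects₁₁.ofFixed Rr.carriers EA EB ℓ` of a two-run datum `Rr` (on any gauge group) for which, member by member `b ∈ ]0, γ′]` of run B's family,
step models `M b` represent `EA ∕ EB b` with (2.13) of activities `act b` as output (`hrep`), THE NODE-A MAJORANT HOLDS AS HYPOTHESIS (near every admissible
box an open set on which every activity is ℂ-differentiable with `‖act b j z Z‖ ≤ C₃ε₁·e^{−R_d·d_j(Z)}` — [II] Lemma 3 (2.38), instanced by nobody), the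
leaves L01–L03, L05–L09unit, the located numerals, the [KP86] clause, the reach clause L10 and the sharp clause hold on a window `W ⊇ ]0, θ.γ]^ℕ` of radius
`γ′ ≥ θ.γ` (module 1's binder list VERBATIM), and the record's letters dominate the END's (`ℓ.κ ≤ κ`, `θ′ ≤ ℓ.θ₅`, `C₅(C₃ε₁) ≤ ℓ.C₅`), then
`S_N18 (RRec₁₁ 𝔯)` — module 4's `n18At_level_ofFixed_of_envelopeOnRecord` (∘ module 1's `n18At_of_envelopeOnRecord` ∘ the END
`EnvelopeOnRecord.ne5_of_leaves_fibre_activities_record_eps`) ONCE per key and level.  The decidability instances of `locE` are the classical ones here.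
[cite: Balaban1988RG2Cluster, Lemma 3 (2.38) p.20 and (2.13) p.14; Balaban1987RG1, Thm 1 p.259] -/
theorem s_N18_rRec₁₁_of_envelopeOnRecord
    (h : ∀ (F : T4Family) (θ : Stage11Params F N), θ.Provisos₁₁ → θ.Admissible → ∀ (g₀ : ℕ → ℝ) (os : List (ULoop F)),
      ∃ (G : Type) (_ : GaugeGroup G) (Rr : TwoRuns G) (Op : Type) (_ : NormedAddCommGroup Op) (_ : NormedSpace ℂ Op)
        (Hist : Type) (_ : NormedAddCommGroup Hist) (_ : NormedSpace ℂ Hist) (M : ℝ → StepModel Rr.carriers Op Hist)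
        (act : ℝ → (j : ℕ) → Op × Hist → TDom 4 (Rr.cubesPerDir j) → ℂ) (W : Set (ℕ → ℝ)) (γ' C3 ε₁ Rd κ : ℝ)
        (EA : Functional Rr.carriers Rr.carriers.BgA) (EB : ℝ → Functional Rr.carriers Rr.carriers.BgB)
        (EA₀ E₀ E₁ δ δ' θr θ' cH ω ρ₀ B : ℝ) (k₀ : ℕ) (ℓ : U3Letters₁₁),
        (𝔯.lit F θ g₀ os).u3 = U3Objects₁₁.ofFixed Rr.carriers EA EB ℓ ∧
        (∀ b : ℝ, 0 < b → b ≤ γ' → ∀ (X : Rr.carriers.Dom) (z : Op × Hist),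
          (M b).Out X.1 z.1 z.2 X =
            locE (TTouch (d := 4) (N := Rr.cubesPerDir X.1)) (fun Z : (tsys 4 (Rr.cubesPerDir X.1)).Dom => Z.1) (act b X.1 z)
              X.2.1) ∧
        0 ≤ C3 ∧ 0 ≤ ε₁ ∧ 0 ≤ κ ∧ κ + 2 * (64 * Real.log 162) + 2 ≤ Rd ∧
        C3 * ε₁ * Real.exp (5 * κ + 1) * K₀ 64 8 * 9 * 64 ≤ 1 ∧
        (∀ b : ℝ, 0 < b → b ≤ γ' → ∀ j, ∀ g ∈ W, ∀ (U : Rr.carriers.BgB) (p : Op × Hist), p ∈ (M b).Base j g U →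
          ∃ V : Set (Op × Hist), IsOpen V ∧ (M b).box j p ⊆ V ∧
            (∀ Z : TDom 4 (Rr.cubesPerDir j), DifferentiableOn ℂ (fun z : Op × Hist => act b j z Z) V) ∧
            (∀ z ∈ V, ∀ Z : TDom 4 (Rr.cubesPerDir j), ‖act b j z Z‖ ≤ C3 * ε₁ * Real.exp (-(Rd * torusTreeLen Z.1)))) ∧
        (∀ b : ℝ, 0 < b → b ≤ γ' → L01 (M b) EA W) ∧ (∀ b : ℝ, 0 < b → b ≤ γ' → L02 (M b) (EB b) W) ∧
        (∀ b : ℝ, 0 < b → b ≤ γ' → L03 (M b) (EB b) W) ∧ L05 EA W EA₀ κ ∧ (∀ b : ℝ, 0 < b → b ≤ γ' → L06 (EB b) W E₀ κ) ∧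
        (∀ b : ℝ, 0 < b → b ≤ γ' → L07 (M b) W δ θr) ∧ (∀ b : ℝ, 0 < b → b ≤ γ' → L08 (M b) W κ E₀ δ' θr) ∧
        (∀ b : ℝ, 0 < b → b ≤ γ' → L09aff (M b) W) ∧ (∀ b : ℝ, 0 < b → b ≤ γ' → L09blind (M b) W) ∧
        (∀ b : ℝ, 0 < b → b ≤ γ' → L09hom (M b) W) ∧ (∀ b : ℝ, 0 < b → b ≤ γ' → L09unit (M b) W κ E₁ cH ω) ∧
        0 < E₁ ∧ 0 ≤ δ + δ' ∧ 0 ≤ θr ∧ θr ≤ θ' ∧ θ' ≤ 1 ∧ 0 ≤ cH ∧ 0 < ω ∧ ρ₀ < 1 ∧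
        (δ + δ') * θr ^ k₀ + cH * (EA₀ + E₀) / (1 - ω) ≤ ρ₀ ∧ 0 ≤ B ∧ (∀ k < k₀, EA₀ + E₀ ≤ B * θr ^ k) ∧
        Real.exp 1 * 9 * 64 * K₀ 64 8 ^ 2 * C3 * cH * ε₁ < (θ' - ω) * (1 - ρ₀) ∧
        Window θ.γ ⊆ W ∧ θ.γ ≤ γ' ∧ ℓ.κ ≤ κ ∧ θ' ≤ ℓ.θ₅ ∧
        (Real.exp 1 * 9 * 64 * K₀ 64 8 ^ 2 * (C3 * ε₁) / (1 - ρ₀) * (δ + δ') + B) * (θ' - ω) /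
            (θ' - (ω + Real.exp 1 * 9 * 64 * K₀ 64 8 ^ 2 * (C3 * ε₁) / (1 - ρ₀) * cH)) ≤ ℓ.C₅) :
    S_N18 (RRec₁₁ 𝔯) := by
  refine s_N18_rRec₁₁_of_forall_admissible 𝔯 fun F θ hP hA g₀ os k => ?_
  obtain ⟨G, _, Rr, Op, _, _, Hist, _, _, M, act, W, γ', C3, ε₁, Rd, κ, EA, EB, EA₀, E₀, E₁, δ, δ', θr, θ', cH, ω, ρ₀, B, k₀, ℓ, hu,
    hrep, hC3, hε₁, hκ, hrate, hKP, hH, l01, l02, l03, l05, l06, l07, l08, l09aff, l09blind, l09hom, l09unit, hE₁, hδ, hθ, hθθ', hθ'1,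
    hcH, hω, hρ₀, l10near, hB, l10first, hS, hW, hγ, hℓκ, hℓθ, hℓC⟩ := h F θ hP hA g₀ os
  rw [hu]
  exact n18At_level_ofFixed_of_envelopeOnRecord Rr M hrep hC3 hε₁ hκ hrate hKP hH l01 l02 l03 l05 l06 l07 l08 l09aff l09blind l09hom
    l09unit hE₁ hδ hθ hθθ' hθ'1 hcH hω hρ₀ l10near hB l10first hS ℓ hW hγ hℓκ hℓθ hℓC k

/-! ## §4 The tower reading at the home -/

/-- **THE TOWER READING AT THE RATE-RECORD HOME** [bookkeeping]: if at every admissible tuple with provisos and every `(g₀, os)` the reading's U3 objects ARE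
`t.objects ℓ` for an object tower `t : U3Tower₁₁` (ONE physical domain type, level `k` = scale `k − r X`, one ambient background type, transports `t.tr k`,
level functionals `t.E k`, run B through `prependCoupling`) and at EVERY level `k` some U3 bundle `v` with `N18At v` (an END's) is read through maps
`φD : t.Dom → v.C.Dom`, `φA φB : t.B → v.C.BgA ∕ v.C.BgB` preserving the level-`k` scale and the tree length and commuting with the transports, with
`t.E k` (at transported backgrounds) and `t.E (k+1) ∘ prependCoupling b` (`b ∈ ]0, θ.γ]`) AGREEING on `]0, θ.γ]^ℕ` with `v`'s functionals through the maps,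
and the record's letters dominating `v`'s, then `S_N18 (RRec₁₁ 𝔯)` — module 4's `n18At_level_tower_of_comap_agree` once per key and level.
[cite: Balaban1987RG1, (0.24)–(0.25) p.257, (1.18) p.263, Thm 1 p.259] -/
theorem s_N18_rRec₁₁_of_tower
    (h : ∀ (F : T4Family) (θ : Stage11Params F N), θ.Provisos₁₁ → θ.Admissible → ∀ (g₀ : ℕ → ℝ) (os : List (ULoop F)),
      ∃ (t : U3Tower₁₁) (ℓ : U3Letters₁₁), (𝔯.lit F θ g₀ os).u3 = t.objects ℓ ∧
        ∀ k : ℕ, ∃ (v : U3Carriers) (φD : t.Dom → v.C.Dom) (φA : t.B → v.C.BgA) (φB : t.B → v.C.BgB),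
          N18At v ∧ (∀ X, v.C.scale (φD X) = k - t.r X) ∧ (∀ X, v.C.d (φD X) = t.d X) ∧
          (∀ U, φA (t.tr k U) = v.C.transport (φB U)) ∧
          (∀ g ∈ Window θ.γ, ∀ (U : t.B) (X : t.Dom), t.E k g (t.tr k U) X = v.EA g (φA (t.tr k U)) (φD X)) ∧
          (∀ b : ℝ, 0 < b → b ≤ θ.γ → ∀ g ∈ Window θ.γ, ∀ (U : t.B) (X : t.Dom),
            t.E (k + 1) (prependCoupling b g) U X = v.EB b g (φB U) (φD X)) ∧
          Window θ.γ ⊆ v.W ∧ θ.γ ≤ v.γ ∧ ℓ.κ ≤ v.κ ∧ 0 ≤ v.θ ∧ v.θ ≤ ℓ.θ₅ ∧ 0 ≤ v.C₅ ∧ v.C₅ ≤ ℓ.C₅) :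
    S_N18 (RRec₁₁ 𝔯) := by
  refine s_N18_rRec₁₁_of_forall_admissible 𝔯 fun F θ hP hA g₀ os k => ?_
  obtain ⟨t, ℓ, hu, hk⟩ := h F θ hP hA g₀ os
  obtain ⟨v, φD, φA, φB, hv, hscale, hd, htr, hAg, hBg, hW, hγ, hκ, hθ, hθ', hC₅, hC⟩ := hk k
  rw [hu]
  exact n18At_level_tower_of_comap_agree t ℓ θ.γ k v hv φD φA φB hscale hd htr hAg hBg hW hγ hκ hθ hθ' hC₅ hC

/-! ## §5 Located vacuity: the stub at the home certifies nothing by itself -/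

/-- **LOCATED VACUITY** [honesty]: a reading whose level functionals VANISH identically (`u.EA k = 0`, `u.EB k b = 0` at every admissible tuple) with
nonnegative `θ₅`, `C₅` satisfies `S_N18 (RRec₁₁ 𝔯)` WITH NO ESTIMATE (`|0 − 0| ≤ C₅·θ₅^j·e^{−κ d}`).  So `S_N18` at the home is NE5's content exactly for
the PINNED reading — W1's (2.13) functionals of record — and nothing is certified over a residual `𝔯`; for other junk it is refutable
(`YMDAG.N18.not_s_N18_of_admits`). [folklore] -/
theorem s_N18_rRec₁₁_of_null
    (h : ∀ (F : T4Family) (θ : Stage11Params F N), θ.Provisos₁₁ → θ.Admissible → ∀ (g₀ : ℕ → ℝ) (os : List (ULoop F)) (k : ℕ),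
      (∀ g U X, (𝔯.lit F θ g₀ os).u3.EA k g U X = 0) ∧ (∀ b g U X, (𝔯.lit F θ g₀ os).u3.EB k b g U X = 0) ∧
      0 ≤ (𝔯.lit F θ g₀ os).u3.θ₅ ∧ 0 ≤ (𝔯.lit F θ g₀ os).u3.C₅) :
    S_N18 (RRec₁₁ 𝔯) := by
  refine s_N18_rRec₁₁_of_forall_ne5 𝔯 fun F θ hP hA g₀ os k b _ _ g _ U X => ?_
  obtain ⟨hA0, hB0, hθ₅, hC₅⟩ := h F θ hP hA g₀ os k
  rw [hA0, hB0, sub_self, abs_zero]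
  positivity

/-! ## §6 The reading in the definer's currency: NE5 for Bałaban's (2.13) terms of record (W1, `Node00/HistoryTermsOfRecord`) -/

section W1Currency

variable {P P' : Params} {𝔸 : Type*} {M M' : ℕ} (S : Node00.W1.ClusterTower P 𝔸 M) (S' : Node00.W1.ClusterTower P' 𝔸 M')
variable {BA BB : Type} (gauge : BA → BA → ℝ) (hg : ∀ U U', 0 ≤ gauge U U') (tr : BB → BA)
variable (embA : BA → Node00.Sect2.CPair P 𝔸) (embB : BB → Node00.Sect2.CPair P' 𝔸) (π : Node00.W1.Dom P M → Node00.W1.Dom P' M')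
variable (ℓ : U3Letters₁₁) {F : T4Family} (θ : Stage11Params F N) (k : ℕ)

/-- **N18 AT THE HOME IN W1's CURRENCY — WHAT NE5 SAYS FOR BAŁABAN's (2.13) TERMS OF RECORD** (`Iff.rfl`).  Objects: run A's tower of one-step cluster
data `S` on the torus parameters `P` (its terms `E^{(j)}(X; g₀,…,g_{j−1}; (𝐔,𝐉))` = `Node00.W1.functionalC S`, (2.13) AS A DEFINITION), run B's tower
`S′` on `P′`, and the UNPRINTED two-run pairing data W1 leaves to the N18 side, here PARAMETERS: run-A ∕ run-B background types `BA ∕ BB` with their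
readings `embA ∕ embB` in the configuration types `Φ`, the closeness gauge, the one-step transport `tr : BB → BA`, and the domain pairing
`π : (j, X) ↦` run B's domain of the same physical extent (nothing about `π` is required by the statement — scale and tree length are read on run A's
`(j, X)`).  Then N18 at the bundle of record of the fixed-carrier U3 objects `ofFixed (histCarriers P M ⟨BA, BB, gauge, tr⟩) (functionalOn S … embA)
(b g U X ↦ Re E_B(πX; b∷g; embB U)) ℓ` at ANY level `k` IS: for every member `b ∈ ]0, θ.γ]`, every history `g ∈ ]0, θ.γ]^ℕ`, every run-B background `U`
and every run-A domain `(j, X)`,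
`|Re E_A^{(j)}(X; g; embA (tr U)) − Re E_B(πX; b∷g; embB U)| ≤ ℓ.C₅ · ℓ.θ₅ ^ j · e^{−ℓ.κ·d_j(X)}` — the η-rate of the one-step outputs as functionals of
the background, BY NAME on the definer's objects.  PINNING the reading `𝔯` to these objects is nobody's yet (LOCATED); proving the inequality is N18's
estimate (NOT in print). [cite: Balaban1988RG2Cluster, (2.13) p.14; Balaban1987RG1, (0.24)–(0.25) p.257, (1.18) p.263 and Thm 1 p.259] -/
theorem n18At_u3OfRecord₁₁_histCarriers_iff :
    N18At (u3OfRecord₁₁ θ (U3Objects₁₁.ofFixed (Node00.W1.histCarriers P M ⟨BA, BB, gauge, hg, tr⟩)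
      (Node00.W1.functionalOn S ⟨BA, BB, gauge, hg, tr⟩ embA)
      (fun b g U X => (Node00.W1.functionalC S' (prependCoupling b g) (embB U) (π X)).re) ℓ) k) ↔
    ∀ b : ℝ, 0 < b → b ≤ θ.γ → ∀ g ∈ Window θ.γ, ∀ (U : BB) (X : Node00.W1.Dom P M),
      |(Node00.W1.functionalC S g (embA (tr U)) X).re - (Node00.W1.functionalC S' (prependCoupling b g) (embB U) (π X)).re| ≤
        ℓ.C₅ * ℓ.θ₅ ^ X.1 * Real.exp (-(ℓ.κ * (Node00.Sect2.domSys P M X.1).dj X.2)) :=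
  Iff.rfl

end W1Currency

/-- **`S_N18` AT THE HOME FOR A READING PINNED TO W1's OBJECTS** [bookkeeping]: if at every admissible Stage-11 tuple with provisos and every `(g₀, os)` the
reading's U3 objects ARE the fixed-carrier objects of §6 for some towers of one-step cluster data `S ∕ S′` (runs A ∕ B), pairing data and letter block `ℓ`,
AND the displayed η-rate inequality holds for their (2.13) terms on `]0, θ.γ]`, then `S_N18 (RRec₁₁ 𝔯)`.  The first conjunct is the definer's PIN (nobody's
yet); the second is NE5's content for Bałaban's terms — by §3 it follows from NODE A's (2.38) majorant through the H-layer END once the towers carry the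
END's step-model representation; neither is asserted here. [cite: Balaban1988RG2Cluster, (2.13) p.14 and Lemma 3 (2.38) p.20; Balaban1987RG1, Thm 1 p.259] -/
theorem s_N18_rRec₁₁_of_histCarriers
    (h : ∀ (F : T4Family) (θ : Stage11Params F N), θ.Provisos₁₁ → θ.Admissible → ∀ (g₀ : ℕ → ℝ) (os : List (ULoop F)),
      ∃ (P P' : Params) (𝔸 : Type) (M M' : ℕ) (S : Node00.W1.ClusterTower P 𝔸 M) (S' : Node00.W1.ClusterTower P' 𝔸 M')
        (BA BB : Type) (gauge : BA → BA → ℝ) (hg : ∀ U U', 0 ≤ gauge U U') (tr : BB → BA)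
        (embA : BA → Node00.Sect2.CPair P 𝔸) (embB : BB → Node00.Sect2.CPair P' 𝔸) (π : Node00.W1.Dom P M → Node00.W1.Dom P' M')
        (ℓ : U3Letters₁₁),
        (𝔯.lit F θ g₀ os).u3 = U3Objects₁₁.ofFixed (Node00.W1.histCarriers P M ⟨BA, BB, gauge, hg, tr⟩)
          (Node00.W1.functionalOn S ⟨BA, BB, gauge, hg, tr⟩ embA)
          (fun b g U X => (Node00.W1.functionalC S' (prependCoupling b g) (embB U) (π X)).re) ℓ ∧
        ∀ b : ℝ, 0 < b → b ≤ θ.γ → ∀ g ∈ Window θ.γ, ∀ (U : BB) (X : Node00.W1.Dom P M),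
          |(Node00.W1.functionalC S g (embA (tr U)) X).re - (Node00.W1.functionalC S' (prependCoupling b g) (embB U) (π X)).re| ≤
            ℓ.C₅ * ℓ.θ₅ ^ X.1 * Real.exp (-(ℓ.κ * (Node00.Sect2.domSys P M X.1).dj X.2))) :
    S_N18 (RRec₁₁ 𝔯) := by
  refine s_N18_rRec₁₁_of_forall_admissible 𝔯 fun F θ hP hA g₀ os k => ?_
  obtain ⟨P, P', 𝔸, M, M', S, S', BA, BB, gauge, hg, tr, embA, embB, π, ℓ, hu, hN⟩ := h F θ hP hA g₀ os
  rw [hu]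
  exact (n18At_u3OfRecord₁₁_histCarriers_iff S S' gauge hg tr embA embB π ℓ θ k).2 hN

end YMDAG.N18.HLayer

end
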